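import Summits.BirchSwinnertonDyer.BirchSwinnertonDyer.Theorems.ByReductionTypeAtTwoAdditiveKatoTransportDescentNegTwoModelDoors
import HarnessLib

/-!
# Route ByReductionTypeAtTwo, crux C4″ `AdditivePotMultOverKAtTwo` (stmt-BirchSwinnertonDyer-22618; parent
# `AdditiveRankZeroAtTwo` 19098) — the (−2)-SPLIT-TWIST block doors AT PRINT LEVEL keyed by the (−1) Literature CONSTRUCTION
# fact `Kato2004.exists_splitTwistDivisibilityInputsDescent_negOne_two` instead of the Summits `@[conjecture]` constant: the
# Print and Final levels of the (−2) chain re-run (theorems only)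

Cell `bsd-2adic`, seat `bsd-2adic-k4-w3` GEN 8 (explicit unit of director-bsd g16 (309)(7); R-B80 (1) of addL2x GEN 17).
Companion of `…DescentNegTwoDoors.lean` (the (−2) base doors, every generator) and `…DescentNegTwoModelDoors.lean`
(Decomposition / Model levels); (−2)-twin of addL2x GEN 17's `…AdditiveKatoTransportDescentFinalDoors.lean`. FIELD FOR FIELD the
(−2)-block theorems of `…PrintDoors.lean` §2 (GEN 5) and `…PrintExactAnyImageFinalDoors.lean` §3 (−2) (GEN 6), with
`hPE : KatoOddBranchInputsAtTwoNegOneSplitTwistPrintExactAnyImage` (resp. its R15-image `…NegTwo…AnyImage`) replaced by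
`hDesc : Kato2004.exists_splitTwistDivisibilityInputsDescent_negOne_two` and the `𝐇¹_Γ`-pin binder `I` dropped (the base doors
supply it). The base doors being stated for EVERY generator (`…DescentNegTwoDoors`: the normalisation `κ_cyc = 5` is
incompatible with `γ·√−2 = √−2` and is performed as a WLOG below the model door), every higher level is the GEN 4–6 text with
ONE base-door name swapped. Every model / decomposition / functional-equation / isogeny / non-vanishing ingredient is the cell's
existing KERNEL theorem, imported BY NAME (t42 GEN 21–24, k4-w3 GEN 2–6, addL2x GEN 15–17).

* §3 `katoDivisibility_negTwoSplitTwist_two_of_print_of_descent` — print level (model over `ℚ(√−2)` SUPPLIED by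
  `AddKatoTwoQuadLayerTwist.exists_selmerInfty_model_of_sq_eq`), for a generator FIXING `√−2`.
* §4 **`katoDivisibility_negTwoSplitTwist_two_of_descent_of_analyticRank_eq_zero`** — THE (−2)-BLOCK DOORS for EVERY
  generator `γ` matching the cyclotomic variable and `r_an(W) = 0`: the statement of GEN 6's
  `katoDivisibility_negTwoSplitTwist_two_of_print_of_analyticRank_eq_zero` VERBATIM with `hPE ↦ hDesc` — from {`Kato2004.thm12_4`,
  Greenberg Thm. 1.14 ×2, Greenberg Thm. 1.5, modularity `hasEntireLFunction_rat`} (PRINT, BY NAME) + the (−1) Literature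
  construction fact: `∃ L̃ ∈ Λ`, `ι L̃ = L⁻₂(f, 1, ω·χ₂, T)`, `L̃ ≠ 0`, with (i) `ℓ_𝔮(X(W/ℚ_∞)) ≤ ℓ_𝔮(Λ/(L̃))` at every height-one
  `𝔮 ∌ 2` for every key-`γ` dual Selmer datum, (ii) the same for every key-`γ⁻¹` datum, (iii) the same for every key-`γ`
  datum of every `W₁ ∼_ℚ W`.

HONEST FRAMING (D-0036 / D-0054): theorems only — no definition, no named fact, no instance, no `sorry`; route-independent;
CONDITIONAL on `Kato2004.thm12_4`, `Greenberg1999_thm114_charIdeal_iota_invariant`,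
`Greenberg1999.thm114_charIdeal_iota_invariant_splitMult_baseChange`, `Greenberg1999.thm15_isTorsion_multiplicative_rat`,
`hasEntireLFunction_rat` (PRINT, BY NAME) and on the Literature construction fact
`Kato2004.exists_splitTwistDivisibilityInputsDescent_negOne_two` (review-accepted p724228; debt of addL2x); types-the-object-of
(the Iwasawa-level word of the (−2)-split-twist sub-block of C4″ becomes «PRINT ×5 + ONE Literature construction fact +
`r_an(W) = 0` + the objects themselves», the Summits `@[conjecture]` constant SUPERSEDED for this block too); closes none (the
block targets `KatoSharpAtTwoAdditiveNegTwoSplitTwist` / `KatoMemberSharpAtTwoAdditiveNegTwoSplitTwistReducible` still need the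
descent READING T1–T14 / R1–R13 and, on the irreducible part, (A)); nothing booked; BSD is not proved by any of this.
PARTITION: X5@2 additive potentially-multiplicative block, the (−2)-split sub-block (39 classes; 30 irreducible, 9 reducible)
× `p = 2`.

References: [Kato2004Asterisque] Thm. 12.4 (p. 221), Thm. 12.5 (3) with (12.5.1) (p. 222), Thm. 17.4 (1) (p. 273), §17.13
(pp. 279–280); [GreenbergLNM1716] §1 (p. 60), Thm. 1.5 (p. 61), Thm. 1.14 (p. 68), §4 (p. 107); [Greenberg1989] pp. 101–102;
[GreenbergVatsal2000] §2 (p. 28); [MazurTateTeitelbaum1986Invent] §I.8, §I.12–I.14, §I.13, §I.17; [Washington1997] §13.1;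
memos `run/shared/lean/pub/bsd-2adic/k4w3/gen8/VERDICT-22618-k4w3-GEN8.md`, `…/addL2x/VERDICT-19098-addL2x-GEN17.md`.
-/

set_option autoImplicit false
-- the summit's namespace `Summit.BirchSwinnertonDyer.BirchSwinnertonDyer` (Sub = Summit) trips `dupNamespace`
set_option linter.dupNamespace false

noncomputable section

open scoped Classical MatrixGroups ModularForm NumberField

open Field CongruenceSubgroup WeierstrassCurve IsDedekindDomain Literature.NumberTheory.EllipticCurves
  Literature.NumberTheory.EllipticCurves.ModularForms Literature.NumberTheory.EllipticCurves.IwasawaAlgebra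
  Literature.NumberTheory.EllipticCurves.Module Literature.NumberTheory.EllipticCurves.QuadraticLayer
  Literature.NumberTheory.EllipticCurves.Greenberg1999 Literature.NumberTheory.GaloisRepresentations
  Summit.BirchSwinnertonDyer.BirchSwinnertonDyer.Theorems

namespace Summit.BirchSwinnertonDyer.BirchSwinnertonDyer.Theorems.AddKatoTwo

/-! ## §3 The (−2)-block doors at print level, for a generator FIXING `√−2` -/

section Print

variable (W : WeierstrassCurve ℚ) [W.IsElliptic] [W.IsGloballyMinimal] [ContinuousSMul ℤ_[2] (W.tateModule 2)]
  (W' : WeierstrassCurve ℚ) [W'.IsElliptic] [W'.IsGloballyMinimal] {V : VariableChange ℚ} (hV : V • W = W'.quadraticTwist (-2))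
  {θ : AlgebraicClosure ℚ} (hθ : θ ^ 2 = algebraMap ℚ (AlgebraicClosure ℚ) (-2))
  {N : ℕ} [NeZero N] (f : CuspForm (Gamma0 N) 2) (κ : ZpExtension ℚ 2) (γ : absoluteGaloisGroup ℚ)
  (hsp : (W.quadraticTwist (-2)).HasSplitMultiplicativeReductionAtPrime 2)
  (hκ : κ.IsCyclotomic) (hγ : κ.IsTopGenerator γ) (hγ' : IsCyclotomicVariable 2 γ) (hγθ : γ • θ = θ)
  (hf : IsNewformOf (W.quadraticTwist (-2)) f)
  (Lt : IwasawaAlgebra 2) (m : ℕ)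
  (hLt : iwasawaToPowerSeries 2 Lt =
    PowerSeries.C ((2 : ℚ_[2]) ^ m) * padicLFunctionMinusBranchMultTwist f (1 : ℚ_[2]) 1 (-1))
  (hLt0 : Lt ≠ 0)
  -- the quadratic field `F = ℚ(√−2)` (any model)
  (F : Type) [Field F] [NumberField F] {θF : F} (hθF : θF ^ 2 = -2) (hF2 : Module.finrank ℚ F = 2)

include hθF in
/-- `θ_F² = −2` in `algebraMap` form. [folklore] -/
private theorem sq_eq_algebraMap_neg_two' : θF ^ 2 = algebraMap ℚ F (-2) := by
  rw [hθF, map_neg, map_ofNat]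

include hV hθ hsp hκ hγ hγ' hγθ hf hLt hLt0 hθF hF2 in
/-- **THE (−2)-BLOCK DOORS AT PRINT LEVEL keyed by the (−1) Literature fact — key `γ`, key `γ⁻¹` and every `ℚ`-isogenous member
at once, for a generator `γ` matching the cyclotomic variable and FIXING `√−2`**: from {`Kato2004.thm12_4`, Greenberg Thm. 1.14
×2, Greenberg Thm. 1.5} (PRINT, BY NAME), the Literature construction fact (through R15), and DATA (`W′` with
`V • W = W′^{(−2)}`, `θ`, `f`, `F ∋ θ_F` with `θ_F² = −2`, `L̃ = 2^m·L⁻₂ ≠ 0` for the `ω·χ₂`-branch). Proof: §2 with the model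
SUPPLIED by `AddKatoTwoQuadLayerTwist.exists_selmerInfty_model_of_sq_eq` (t42 GEN 24, every `d < 0`) and `hF` SUPPLIED
(`AddKatoTwoQuadLayerModel.hasSplitMultiplicativeReductionAt_baseChange_of_two_mem`). Twin of
`katoDivisibility_negTwoSplitTwist_two_of_print_of_input` (no `I` binder: the base doors supply the pin).
[cite: Kato2004Asterisque, Thm. 12.4 (p. 221), Thm. 12.5 (3) and (12.5.1) (p. 222), Thm. 17.4 (1) (p. 273), §8.3 (p. 181), §17.13 (pp. 279–280)]
[cite: GreenbergLNM1716, Thm. 1.5 (p. 61), Thm. 1.14 (p. 68), §4 (p. 107)] [cite: GreenbergVatsal2000, §2 (p. 28)]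
[cite: MazurTateTeitelbaum1986Invent, §I.13, §I.17] [cite: Greenberg1989, pp. 101–102 (S^ι)] -/
theorem katoDivisibility_negTwoSplitTwist_two_of_print_of_descent
    (hDesc : Kato2004.exists_splitTwistDivisibilityInputsDescent_negOne_two) (h12 : Kato2004.thm12_4)
    (h114 : Greenberg1999_thm114_charIdeal_iota_invariant)
    (h114F : Greenberg1999.thm114_charIdeal_iota_invariant_splitMult_baseChange) (h15 : thm15_isTorsion_multiplicative_rat) :
    (∀ (D : W.SelmerDualData κ γ) (𝔮 : PrimeSpectrum (IwasawaAlgebra 2)), 𝔮.asIdeal.height = 1 →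
      PowerSeries.C (2 : ℤ_[2]) ∉ 𝔮.asIdeal →
      lengthAt (IwasawaAlgebra 2) D.X 𝔮 ≤ lengthAt (IwasawaAlgebra 2) (IwasawaAlgebra 2 ⧸ Ideal.span {Lt}) 𝔮) ∧
    (∀ (D' : W.SelmerDualData κ γ⁻¹) (𝔮 : PrimeSpectrum (IwasawaAlgebra 2)), 𝔮.asIdeal.height = 1 →
      PowerSeries.C (2 : ℤ_[2]) ∉ 𝔮.asIdeal →
      lengthAt (IwasawaAlgebra 2) D'.X 𝔮 ≤ lengthAt (IwasawaAlgebra 2) (IwasawaAlgebra 2 ⧸ Ideal.span {Lt}) 𝔮) ∧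
    (∀ (W₁ : WeierstrassCurve ℚ) [W₁.IsElliptic], IsIsogenous W W₁ →
      ∀ (D₁ : W₁.SelmerDualData κ γ) (𝔮 : PrimeSpectrum (IwasawaAlgebra 2)), 𝔮.asIdeal.height = 1 →
      PowerSeries.C (2 : ℤ_[2]) ∉ 𝔮.asIdeal →
      lengthAt (IwasawaAlgebra 2) D₁.X 𝔮 ≤ lengthAt (IwasawaAlgebra 2) (IwasawaAlgebra 2 ⧸ Ideal.span {Lt}) 𝔮) := by
  haveI : Fact (Nat.Prime 2) := ⟨Nat.prime_two⟩
  haveI : (kerStab κ θ).Normal := normal_kerStab κ hθ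
  have hsp' : W'.HasSplitMultiplicativeReductionAtPrime 2 :=
    hasSplitMultiplicativeReductionAtPrime_twistModel W W' (by norm_num) hV 2 hsp
  have hF : ∀ v : HeightOneSpectrum (𝓞 F), (2 : 𝓞 F) ∈ v.asIdeal → (W'.baseChange F).HasSplitMultiplicativeReductionAt v :=
    fun v hv ↦ AddKatoTwoQuadLayerModel.hasSplitMultiplicativeReductionAt_baseChange_of_two_mem W' hsp' F v hv
  obtain ⟨κF, γF, hκF, hγF, -, -, ΘS, hΘS⟩ := AddKatoTwoQuadLayerTwist.exists_selmerInfty_model_of_sq_eq κ hκ W' hθ hγ hγθ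
    (by norm_num : (-2 : ℚ) < 0) F (sq_eq_algebraMap_neg_two' F hθF) hF2
  have hD := lengthAt_selmerDual_le_of_splitTwistDescent_negTwo_fe_of_model W W' hV hθ f κ γ hsp hκ hγ hγ' hγθ hf F hF κF γF
    hκF hγF ((W'.baseChange F).selmerDualData κF hγF) ΘS hΘS Lt m hLt hLt0 hDesc h12 h114 h114F h15
  refine ⟨hD, ?_, ?_⟩
  · exact lengthAt_selmerDualContra_le_of_splitTwistDescent_negTwo_fe_of_model W W' hV hθ f κ γ hsp hκ hγ hγ' hγθ hf F hF κF
      γF hκF hγF ((W'.baseChange F).selmerDualData κF hγF) ΘS hΘS Lt m hLt hLt0 hDesc h12 h114 h114F h15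
  · intro W₁ _ hiso D₁ 𝔮 h𝔮 hp𝔮
    have hp𝔮' : PowerSeries.C ((2 : ℕ) : ℤ_[2]) ∉ 𝔮.asIdeal := by exact_mod_cast hp𝔮
    rw [← lengthAt_selmerDual_eq_of_isIsogenous hiso (W.selmerDualData κ hγ) D₁ 𝔮 hp𝔮']
    exact hD (W.selmerDualData κ hγ) 𝔮 h𝔮 hp𝔮

end Print

/-! ## §4 The (−2)-block doors for EVERY generator and `r_an(W) = 0` -/

section Final

variable (W : WeierstrassCurve ℚ) [W.IsElliptic] [W.IsGloballyMinimal] [ContinuousSMul ℤ_[2] (W.tateModule 2)]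
  (W' : WeierstrassCurve ℚ) [W'.IsElliptic] [W'.IsGloballyMinimal] {V : VariableChange ℚ} (hV : V • W = W'.quadraticTwist (-2))
  {N : ℕ} [NeZero N] (f : CuspForm (Gamma0 N) 2) (κ : ZpExtension ℚ 2) (γ : absoluteGaloisGroup ℚ)
  (hsp : (W.quadraticTwist (-2)).HasSplitMultiplicativeReductionAtPrime 2)
  (hκ : κ.IsCyclotomic) (hγ : κ.IsTopGenerator γ) (hγ' : IsCyclotomicVariable 2 γ)
  (hf : IsNewformOf (W.quadraticTwist (-2)) f)

include hV hsp hκ hγ hγ' hf in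
/-- **THE (−2)-BLOCK DOORS AT PRINT LEVEL — EVERY generator, keyed by the (−1) Literature CONSTRUCTION fact instead of the
Summits `@[conjecture]` constant.** For the ADDITIVE `W` whose twist by `−2` is split multiplicative at `2`, with `r_an(W) = 0`
(the crux's hypothesis verbatim), from {`Kato2004.thm12_4`, Greenberg Thm. 1.14 over `ℚ` and over `F`, Greenberg Thm. 1.5,
modularity `hasEntireLFunction_rat`} (PRINT, BY NAME), the Literature fact
`Kato2004.exists_splitTwistDivisibilityInputsDescent_negOne_two` (odd-branch descent package of the (−1)-block: printed objects
of Kato's Lemma 17.12 for the Tate curve at `2` + 12.1 descent + the twist dictionary; carried to the (−2)-block by R15 IN THE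
KERNEL, `AddKatoTwoGammaTwist.exists_splitTwistDescent_negTwo_two_of_negOne`), and the objects `W′`, `f`, `κ`, `γ`: there is
`L̃ ∈ Λ = ℤ₂⟦T⟧` with `ι L̃ = L⁻₂(f, 1, ω·χ₂, T)` (the `χ₂`-twisted odd branch of the one-term measure of `W^{(−2)}`) and `L̃ ≠ 0`,
such that (i) `ℓ_𝔮(X(W/ℚ_∞)) ≤ ℓ_𝔮(Λ/(L̃))` at every height-one `𝔮 ∌ 2` for every key-`γ` dual Selmer datum; (ii) the same for
every key-`γ⁻¹` datum; (iii) the same for every key-`γ` datum of every `W₁ ∼_ℚ W`. The statement of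
`katoDivisibility_negTwoSplitTwist_two_of_print_of_analyticRank_eq_zero` with `hPE ↦ hDesc`; proof: §3 at a generator
`γ₀ = γ` or `γ·c` FIXING `√−2` (`c ∈ ker κ` a complex conjugation), `F = ℚ(√−2)` produced, `(L̃, 0)` from
`exists_iwasawa_lift_oddBranchTwist_ne_zero`, then every datum re-keyed.
[cite: Kato2004Asterisque, Thm. 12.4 (p. 221), Thm. 12.5 (3) and (12.5.1) (p. 222), Thm. 17.4 (1) (p. 273), Lemma 17.12 (pp. 278–279), §17.13 (pp. 279–280)]
[cite: GreenbergLNM1716, §1 (p. 60), Thm. 1.5 (p. 61), Thm. 1.14 (p. 68), §4 (p. 107)]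
[cite: MazurTateTeitelbaum1986Invent, §I.8 (8.6), §I.12–I.14, §I.13, §I.17] [cite: Washington1997, §13.1] -/
theorem katoDivisibility_negTwoSplitTwist_two_of_descent_of_analyticRank_eq_zero
    (hDesc : Kato2004.exists_splitTwistDivisibilityInputsDescent_negOne_two) (h12 : Kato2004.thm12_4)
    (h114 : Greenberg1999_thm114_charIdeal_iota_invariant)
    (h114F : Greenberg1999.thm114_charIdeal_iota_invariant_splitMult_baseChange) (h15 : thm15_isTorsion_multiplicative_rat)
    (hmod : hasEntireLFunction_rat) (hr : W.analyticRank = 0) :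
    ∃ Lt : IwasawaAlgebra 2,
      iwasawaToPowerSeries 2 Lt = padicLFunctionMinusBranchMultTwist f (1 : ℚ_[2]) 1 (-1) ∧ Lt ≠ 0 ∧
    (∀ (D : W.SelmerDualData κ γ) (𝔮 : PrimeSpectrum (IwasawaAlgebra 2)), 𝔮.asIdeal.height = 1 →
      PowerSeries.C (2 : ℤ_[2]) ∉ 𝔮.asIdeal →
      lengthAt (IwasawaAlgebra 2) D.X 𝔮 ≤ lengthAt (IwasawaAlgebra 2) (IwasawaAlgebra 2 ⧸ Ideal.span {Lt}) 𝔮) ∧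
    (∀ (D' : W.SelmerDualData κ γ⁻¹) (𝔮 : PrimeSpectrum (IwasawaAlgebra 2)), 𝔮.asIdeal.height = 1 →
      PowerSeries.C (2 : ℤ_[2]) ∉ 𝔮.asIdeal →
      lengthAt (IwasawaAlgebra 2) D'.X 𝔮 ≤ lengthAt (IwasawaAlgebra 2) (IwasawaAlgebra 2 ⧸ Ideal.span {Lt}) 𝔮) ∧
    (∀ (W₁ : WeierstrassCurve ℚ) [W₁.IsElliptic], IsIsogenous W W₁ →
      ∀ (D₁ : W₁.SelmerDualData κ γ) (𝔮 : PrimeSpectrum (IwasawaAlgebra 2)), 𝔮.asIdeal.height = 1 →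
      PowerSeries.C (2 : ℤ_[2]) ∉ 𝔮.asIdeal →
      lengthAt (IwasawaAlgebra 2) D₁.X 𝔮 ≤ lengthAt (IwasawaAlgebra 2) (IwasawaAlgebra 2 ⧸ Ideal.span {Lt}) 𝔮) := by
  haveI : Fact (Nat.Prime 2) := ⟨Nat.prime_two⟩
  haveI : (W.quadraticTwist (-2 : ℚ)).IsElliptic := W.isElliptic_quadraticTwist (by norm_num)
  have hL : W.entireLFunction 1 ≠ 0 := (WeierstrassCurve.analyticRank_eq_zero_iff_holds (hmod W)).mp hr
  -- (α) the twisted odd-branch multiple: `W ≅ (W^{(−2)})^{(−2)}` (`(−2)·(−2) = 1·2²`)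
  have hWtw : ∃ C : VariableChange ℚ, C • (W.quadraticTwist (-2 : ℚ)).quadraticTwist (-2) = W := by
    obtain ⟨C, hC⟩ := W.exists_variableChange_quadraticTwist_one
    obtain ⟨C₂, hC₂⟩ := W.exists_variableChange_quadraticTwist_mul_sq (1 : ℚ) (2 : ℚ) two_ne_zero
    refine ⟨C⁻¹ * C₂⁻¹, ?_⟩
    rw [quadraticTwist_quadraticTwist, show (-2 : ℚ) * -2 = 1 * 2 ^ 2 by norm_num, ← hC₂, ← hC, mul_smul,
      inv_smul_smul, inv_smul_smul]
  obtain ⟨Lt, hLt, hLt0⟩ :=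
    exists_iwasawa_lift_oddBranchTwist_ne_zero W (W.quadraticTwist (-2 : ℚ)) hWtw hf hsp hmod hL
  have hLt' : iwasawaToPowerSeries 2 Lt = padicLFunctionMinusBranchMultTwist f (1 : ℚ_[2]) 1 (-1) := by
    rw [hLt, pow_zero, map_one, one_mul]
  -- (γ) a model of `ℚ(√−2)`
  obtain ⟨F, _, _, θF, hθF, hF2⟩ := exists_numberField_sq_eq_of_neg (d := -2) (by norm_num)
  rw [map_neg, map_ofNat] at hθF
  -- (β) §3 at every generator FIXING `√−2`, then the WLOG
  obtain ⟨θ, hθ⟩ := AddKatoTwoQuadLayer.exists_sqrt (-2)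
  have key : ∀ γ₀ : absoluteGaloisGroup ℚ, κ.IsTopGenerator γ₀ → IsCyclotomicVariable 2 γ₀ → γ₀ • θ = θ →
      (∀ (D : W.SelmerDualData κ γ₀) (𝔮 : PrimeSpectrum (IwasawaAlgebra 2)), 𝔮.asIdeal.height = 1 →
        PowerSeries.C (2 : ℤ_[2]) ∉ 𝔮.asIdeal →
        lengthAt (IwasawaAlgebra 2) D.X 𝔮 ≤ lengthAt (IwasawaAlgebra 2) (IwasawaAlgebra 2 ⧸ Ideal.span {Lt}) 𝔮) ∧
      (∀ (D' : W.SelmerDualData κ γ₀⁻¹) (𝔮 : PrimeSpectrum (IwasawaAlgebra 2)), 𝔮.asIdeal.height = 1 →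
        PowerSeries.C (2 : ℤ_[2]) ∉ 𝔮.asIdeal →
        lengthAt (IwasawaAlgebra 2) D'.X 𝔮 ≤ lengthAt (IwasawaAlgebra 2) (IwasawaAlgebra 2 ⧸ Ideal.span {Lt}) 𝔮) ∧
      (∀ (W₁ : WeierstrassCurve ℚ) [W₁.IsElliptic], IsIsogenous W W₁ →
        ∀ (D₁ : W₁.SelmerDualData κ γ₀) (𝔮 : PrimeSpectrum (IwasawaAlgebra 2)), 𝔮.asIdeal.height = 1 →
        PowerSeries.C (2 : ℤ_[2]) ∉ 𝔮.asIdeal →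
        lengthAt (IwasawaAlgebra 2) D₁.X 𝔮 ≤ lengthAt (IwasawaAlgebra 2) (IwasawaAlgebra 2 ⧸ Ideal.span {Lt}) 𝔮) :=
    fun γ₀ hγ₀ hγ₀' hγ₀θ ↦ katoDivisibility_negTwoSplitTwist_two_of_print_of_descent W W' hV hθ f κ γ₀ hsp hκ hγ₀ hγ₀' hγ₀θ
      hf Lt 0 hLt hLt0 F hθF hF2 hDesc h12 h114 h114F h15
  refine ⟨Lt, hLt', hLt0, ?_⟩
  rcases QuadraticTwistSelmer.smul_sqrt_eq_or_eq_neg hθ γ with hγθ | hγθ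
  · exact key γ hγ hγ' hγθ
  · obtain ⟨c, hc, hcθ⟩ :=
      AddKatoTwoQuadLayer.exists_mem_kerSubgroup_smul_sqrt_eq_neg_of_neg κ (by norm_num : (-2 : ℚ) < 0) hθ
    have hγcθ : (γ * c) • θ = θ := by rw [mul_smul, hcθ, smul_neg, hγθ, neg_neg]
    obtain ⟨h1, h2, h3⟩ := key (γ * c) (isTopGenerator_mul_of_mem_kerSubgroup κ hγ hc)
      (isCyclotomicVariable_mul_of_mem_kerSubgroup κ hκ hγ' hc) hγcθ
    have h2c : PowerSeries.C ((2 : ℕ) : ℤ_[2]) = PowerSeries.C (2 : ℤ_[2]) := by norm_num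
    refine ⟨?_, ?_, ?_⟩
    · have h := forall_selmerDualData_of_rekey (W₀ := W) Lt hc (by simpa only [h2c] using h1)
      simpa only [h2c] using h
    · have h := forall_selmerDualData_inv_of_mul (W₀ := W) Lt hc (by simpa only [h2c] using h2)
      simpa only [h2c] using h
    · intro W₁ _ hiso
      have h := forall_selmerDualData_of_rekey (W₀ := W₁) Lt hc (by simpa only [h2c] using h3 W₁ hiso)
      simpa only [h2c] using h

end Final

end Summit.BirchSwinnertonDyer.BirchSwinnertonDyer.Theorems.AddKatoTwo

end
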